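import Summits.NavierStokesRegularity.NavierStokesRegularity.Theorems.RecurrentProfilesRecurrentLiouvilleLebL3BackwardLiouville
import Literature.Analysis.FluidPDE.OseenAncientKatoClass
import Literature.Analysis.FluidPDE.NSSereginL3BlowupHolds
import HarnessLib

/-!
# Crux `RecurrentLiouville` (stmt-NavierStokesRegularity-1589), line `Sketch` (v8 "Lebesgue rungs") —
  stub S2: Seregin 2012, Thm 1.1 in the class (the final-time `L³` rung)

`stub_lebL3FinalRegularity`: let `(u, p)` be a suitable weak solution of Navier–Stokes (`ν = 1`,
`f = 0`) on the backward slab `ℝ³ × ℝ₋ = (-∞, 0) × ℝ³` with weak gradient `G`, Albritton–Barker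
quantity `𝐈(ℝ³ × ℝ₋) < ∞` and the Type-I rate `‖u(t, x)‖ ≤ C/√(−t)`.  If the slices `u(t)` are
bounded in `L³(ℝ³)` for almost every time `t` of some final interval `(T₀, 0)`, `T₀ < 0`, then the
space–time origin is NOT a backward singular point of `u`.  This is Seregin's necessary condition
for blow-up (`‖u(t)‖₃ → ∞` at a singular time; G. Seregin, Comm. Math. Phys. 312 (2012), Thm 1.1,
building on Escauriaza–Seregin–Šverák 2003) transported to the Albritton–Barker class.

Proof (bookkeeping over tree-proved facts).
* `exists_oseenMild_repr_of_typeIBound_lt_top` (slab form of A–B 2019 Thm 1.1, forward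
  direction): `u` is a.e. equal on the slab to a field `v` continuous on the open slab, with weakly
  divergence-free slices, solving the Oseen integral equation `v(t) = e^{(t−s)Δ}v(s) − B¹ₛ(v,v)(t)`
  for all `s < t < 0`, with the rate `‖v(t, x)‖ ≤ C/√(−t)`.
* Fubini (`lebL3B_ae_slice_ae_eq`): `‖v(t)‖₃ = ‖u(t)‖₃ ≤ M` for a.e. `t ∈ (T₀, 0)`; an interval of
  positive length is not null, so there is a GOOD base time `t_b ∈ (T₀, 0)` (`v(t_b) ∈ L³`, the
  slice being continuous), and good times in every `(−ε, 0)` (`lebL3F_exists_mem_Ioo`).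
* `lebL3F_isKatoSolutionOn_rate`: `s ↦ v(t_b + s)` is a Kato solution on `[0, −t_b)` with datum
  `v(t_b)`: the tree's `oseenAncient_isKatoSolutionOn` (bounded Oseen-mild ancient fields) applied
  to every time shift `w(t) = v(t − δ)`, `δ > 0` — bounded by `C/√δ`, Oseen-mild by
  `oseenDuhamel_translate`, with the slice `w(t_b + δ) = v(t_b)` — gives the Kato package on
  `[0, −t_b − δ)`, glued over `δ = 1/(n+1) ↓ 0` by `isKatoSolutionOn_of_forall`.
* `seregin_regular_of_liminf_L3_holds` (Seregin 2012, Thm 1.1, core form): the good times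
  accumulate at `0⁻`, i.e. `liminf_{s ↑ −t_b} ‖v(t_b + s)‖₃ ≤ M < ∞`, so `s ↦ v(t_b + s)` is
  essentially bounded on some `Q_r(−t_b, 0)`; translating time by `t_b`
  (`eLpNorm_top_comp_stAffine_restrict_preimage`), `v` is essentially bounded on `Q_r(0, 0)`, and
  so is `u = v` a.e. (`Q_r(0,0) ⊆` slab) — contradicting `‖u‖_{L^∞(Q_r(0,0))} = ∞`.

## References

* G. Seregin, *A certain necessary condition of potential blow up for Navier–Stokes equations*,
  Comm. Math. Phys. 312 (2012) 833–845 = arXiv:1104.3615, Thm 1.1, §§2–4. [Seregin2012CMP]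
* L. Escauriaza, G. Seregin, V. Šverák, *`L_{3,∞}`-solutions of Navier–Stokes equations and
  backward uniqueness*, Russian Math. Surveys 58 (2003) 211–250, Thm 1.3, §3. [EscauriazaSereginSverak2003]
* D. Albritton, T. Barker, J. Math. Fluid Mech. 21 (2019) no. 43 = arXiv:1811.00502, Thm 1.1 (§3).
  [AlbrittonBarker2019]
-/

noncomputable section

-- the sub-problem namespace repeats the summit name (D-0017 layout `Summit.<S>.<P>.Theorems`)
set_option linter.dupNamespace false

namespace Summit.NavierStokesRegularity.NavierStokesRegularity.Theorems

open MeasureTheory Set Function Filter Topology TopologicalSpace Metric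
open Literature.Analysis Literature.Analysis.FluidPDE
open scoped NNReal ENNReal

/-! ## A.e. bookkeeping: a good time in every interval -/

/-- **An a.e. property holds somewhere in every nondegenerate interval.**  If `P t` holds for
a.e. real `t`, then for `a < b` some `t ∈ (a, b)` satisfies `P`: the interval has positive length
`b − a`, so it is not contained in the exceptional null set. [folklore] -/
theorem lebL3F_exists_mem_Ioo {P : ℝ → Prop} {a b : ℝ} (hab : a < b)
    (h : ∀ᵐ t ∂(volume : Measure ℝ), P t) : ∃ t ∈ Ioo a b, P t := by
  haveI : (ae ((volume : Measure ℝ).restrict (Ioo a b))).NeBot := by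
    rw [ae_neBot, ne_eq, Measure.restrict_eq_zero, Real.volume_Ioo, ENNReal.ofReal_eq_zero, not_le]
    linarith
  obtain ⟨t, ht, ht'⟩ := ((ae_restrict_mem measurableSet_Ioo).and
    (ae_restrict_of_ae (μ := (volume : Measure ℝ)) (s := Ioo a b) h)).exists
  exact ⟨t, ht, ht'⟩

/-! ## The Kato solution issued from an `L³` slice of a Type-I-rate Oseen-mild ancient field -/

/-- **Kato solution from an `L³` slice in the Type-I-rate Oseen-mild class.**  Let `v` be
continuous on the open slab `(−∞, 0) × ℝ³`, with weakly divergence-free slices, solving the Oseen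
integral equation `v(t) = e^{(t−s)Δ}v(s) − B¹ₛ(v, v)(t)` for all `s < t < 0`, with the rate
`‖v(t, x)‖ ≤ C/√(−t)`.  If `v(τ) ∈ L³(ℝ³)`, then `s ↦ v(τ + s)` is a Kato solution on `[0, −τ)`
with datum `v(τ)` (mild in duality form, `C([0, −τ); L³)`, measurable on the strip): the tree's
`oseenAncient_isKatoSolutionOn` (BOUNDED Oseen-mild ancient fields; Albritton–Barker 2019, §4,
proof of Thm 4.1, via Lemarié-Rieusset 2016, §9.9) applied to every time shift `w(t) = v(t − δ)`,
`δ > 0` — bounded by `C/√δ`, Oseen-mild by `oseenDuhamel_translate`, with the slice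
`w(τ + δ) = v(τ)` — yields the Kato package on `[0, −τ − δ)`; these glue over `δ = 1/(n+1) ↓ 0`
(`isKatoSolutionOn_of_forall`). [cite: AlbrittonBarker2019, §4, proof of Thm 4.1 (arXiv:1811.00502 p. 9)] -/
theorem lebL3F_isKatoSolutionOn_rate
    {v : ℝ → EuclideanSpace ℝ (Fin 3) → EuclideanSpace ℝ (Fin 3)} {C : ℝ}
    (hcont : ContinuousOn (uncurry v) (Iio 0 ×ˢ univ))
    (hdiv : ∀ t < 0, IsWeaklyDivFree (v t))
    (hmild : ∀ s t : ℝ, s < t → t < 0 → ∀ x,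
      v t x = UnboundedOperators.heatExtension (v s) (t - s) x - oseenDuhamel 1 s v v t x)
    (hdec : HasTypeITimeDecay C v)
    {τ : ℝ} (h3 : MemLp (v τ) 3 volume) :
    IsKatoSolutionOn (-τ) 1 (v τ) (fun s => v (τ + s)) := by
  -- `0 ≤ C`, from the rate at `(t, x) = (-1, 0)`
  have hC0 : 0 ≤ C := by
    have h := hdec (-1) (by norm_num) 0
    rw [neg_neg, Real.sqrt_one, div_one] at h
    exact (norm_nonneg _).trans h
  -- from the slice at `τ` up to `-(τ + δ)`, every `δ > 0`: the time shift `w(t) = v(t - δ)`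
  have key : ∀ δ : ℝ, 0 < δ → IsKatoSolutionOn (0 - (τ + δ)) 1 (v τ) (fun s => v (τ + s)) := by
    intro δ hδ
    -- the hypotheses of `oseenAncient_isKatoSolutionOn` for the shifted field
    have hwc : ContinuousOn (uncurry fun r => v (r + -δ)) (Iio 0 ×ˢ univ) := by
      have h1 : ContinuousOn (uncurry v ∘ fun z : ℝ × EuclideanSpace ℝ (Fin 3) => (z.1 + -δ, z.2))
          (Iio 0 ×ˢ univ) := by
        refine hcont.comp (by fun_prop) fun z hz => ⟨?_, mem_univ _⟩
        have hz1 : z.1 < 0 := hz.1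
        show z.1 + -δ < 0
        linarith
      exact h1
    have hwK : ∀ t < 0, ∀ x, ‖(fun r => v (r + -δ)) t x‖ ≤ C / Real.sqrt δ := by
      intro t ht x
      refine (hdec (t + -δ) (by linarith) x).trans ?_
      exact div_le_div_of_nonneg_left hC0 (Real.sqrt_pos.2 hδ) (Real.sqrt_le_sqrt (by linarith))
    have hwd : ∀ t < 0, IsWeaklyDivFree ((fun r => v (r + -δ)) t) := fun t ht =>
      hdiv (t + -δ) (by linarith)
    have hwm : ∀ s t : ℝ, s < t → t < 0 → ∀ x, (fun r => v (r + -δ)) t x =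
        UnboundedOperators.heatExtension ((fun r => v (r + -δ)) s) (t - s) x -
          oseenDuhamel 1 s (fun r => v (r + -δ)) (fun r => v (r + -δ)) t x := by
      intro s t hst ht x
      show v (t + -δ) x = UnboundedOperators.heatExtension (v (s + -δ)) (t - s) x -
        oseenDuhamel 1 s (fun r => v (r + -δ)) (fun r => v (r + -δ)) t x
      rw [oseenDuhamel_translate 1 s (-δ) v v t x,
        hmild (s + -δ) (t + -δ) (by linarith) (by linarith) x, add_sub_add_right_eq_sub]
    -- the good slice `w (τ + δ) = v τ`
    have h3' : MemLp ((fun r => v (r + -δ)) (τ + δ)) 3 volume := by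
      simpa only [add_neg_cancel_right] using h3
    have hK := oseenAncient_isKatoSolutionOn (τ := τ + δ) hwc hwK hwd hwm h3'
    have e2 : ∀ s : ℝ, τ + δ + s + -δ = τ + s := fun s => by ring
    simpa only [add_neg_cancel_right, e2] using hK
  -- glue over `δ = 1/(n+1) ↓ 0`
  refine isKatoSolutionOn_of_forall (T := fun n : ℕ => 0 - (τ + 1 / ((n : ℝ) + 1)))
    (fun n => key _ Nat.one_div_pos_of_nat) (fun n => ?_) fun t ht => ?_
  · have h1 : (0 : ℝ) < 1 / ((n : ℝ) + 1) := Nat.one_div_pos_of_nat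
    show 0 - (τ + 1 / ((n : ℝ) + 1)) ≤ -τ
    linarith
  · obtain ⟨n, hn⟩ := exists_nat_one_div_lt (show (0 : ℝ) < -τ - t by linarith)
    exact ⟨n, show t < 0 - (τ + 1 / ((n : ℝ) + 1)) by linarith⟩

/-! ## Stub S2 — Seregin 2012 Thm 1.1 in the class (final-time `L³` regularity) -/

/-- **S2 — final-time `L³` regularity in the Albritton–Barker class** (Seregin 2012, Thm 1.1,
transported to suitable weak Type-I profiles).  A suitable weak solution `(u,p)` on `ℝ³ × ℝ₋` with
weak gradient `G`, `𝐈 < ⊤` and the rate `C`, whose slices are bounded in `L³(ℝ³)` for almost every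
time of some final interval `(T₀, 0)`, is regular at the space–time origin: pass to the continuous
Oseen-mild representative `v` (`exists_oseenMild_repr_of_typeIBound_lt_top`), restart at a good base
time `t_b ∈ (T₀, 0)` as a Kato solution on `[0, −t_b)` (`lebL3F_isKatoSolutionOn_rate`), feed the
good times accumulating at `0⁻` into Seregin's criterion (`seregin_regular_of_liminf_L3_holds`),
and translate the resulting `L^∞` bound on `Q_r(−t_b, 0)` back to `Q_r(0, 0)` and to `u`.
[cite: Seregin2012CMP, Thm 1.1, §§2–4] [cite: EscauriazaSereginSverak2003, Thm 1.3] -/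
theorem stub_lebL3FinalRegularity :
    ∀ (C : ℝ) (u : ℝ → EuclideanSpace ℝ (Fin 3) → EuclideanSpace ℝ (Fin 3))
      (p : ℝ → EuclideanSpace ℝ (Fin 3) → ℝ)
      (G : ℝ → EuclideanSpace ℝ (Fin 3) → EuclideanSpace ℝ (Fin 3) →L[ℝ] EuclideanSpace ℝ (Fin 3)),
      IsSuitableWeakSolutionOn (slab (EuclideanSpace ℝ (Fin 3)) (Iio 0) isOpen_Iio) 1 0 u p →
      HasWeakSpatialGradientOn (slab (EuclideanSpace ℝ (Fin 3)) (Iio 0) isOpen_Iio) u G →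
      typeIBound (Iio (0 : ℝ) ×ˢ univ) u p G < ⊤ →
      HasTypeITimeDecay C u →
      (∃ (M : ℝ≥0∞) (T₀ : ℝ), M < ⊤ ∧ T₀ < 0 ∧
        ∀ᵐ t ∂(volume : Measure ℝ), T₀ < t → t < 0 → eLpNorm (u t) 3 volume ≤ M) →
      ¬ IsBackwardSingularPoint u 0 := by
  intro C u p G hsw _hwg hI hdec hL3 hsing
  obtain ⟨M, T₀, hM, hT₀, hbd⟩ := hL3
  -- the continuous Oseen-mild representative with the rate
  obtain ⟨v, hae, hcont, hdiv, hmild, hdecv⟩ :=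
    exists_oseenMild_repr_of_typeIBound_lt_top hsw hdec hI
  -- good `L³` slices of `v`: a.e. `t ∈ (T₀, 0)`
  have hslice : ∀ᵐ t ∂((volume : Measure ℝ).restrict (Iio 0)), u t =ᵐ[volume] v t :=
    lebL3B_ae_slice_ae_eq hae
  have hgood : ∀ᵐ t ∂(volume : Measure ℝ), T₀ < t → t < 0 → eLpNorm (v t) 3 volume ≤ M := by
    filter_upwards [hbd, (ae_restrict_iff' measurableSet_Iio).1 hslice] with t h1 h2
    intro hT ht
    rw [← eLpNorm_congr_ae (h2 ht)]
    exact h1 hT ht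
  -- a good base time `tb ∈ (T₀, 0)`: `v tb ∈ L³` (the slice is continuous, hence measurable)
  obtain ⟨tb, htb, htbM⟩ := lebL3F_exists_mem_Ioo hT₀ hgood
  have hvc : Continuous (v tb) :=
    hcont.comp_continuous (f := fun x : EuclideanSpace ℝ (Fin 3) => (tb, x)) (by fun_prop)
      fun x => ⟨htb.2, mem_univ x⟩
  have h3 : MemLp (v tb) 3 volume := ⟨hvc.aestronglyMeasurable, (htbM htb.1 htb.2).trans_lt hM⟩
  -- the Kato solution `s ↦ v (tb + s)` on `[0, -tb)` issued from the slice `v tb`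
  have hU : IsKatoSolutionOn (-tb) 1 (v tb) (fun s => v (tb + s)) :=
    lebL3F_isKatoSolutionOn_rate hcont hdiv hmild hdecv h3
  -- `liminf_{s ↑ -tb} ‖v(tb + s)‖₃ ≤ M`: the good times accumulate at `0⁻`
  have hlim : ∃ M' : ℝ≥0, ∃ᶠ s in 𝓝[<] (-tb), eLpNorm (v (tb + s)) 3 volume ≤ M' := by
    refine ⟨M.toNNReal, ?_⟩
    rw [ENNReal.coe_toNNReal hM.ne, Filter.frequently_iff]
    intro U hU'
    obtain ⟨a, ha, haU⟩ := mem_nhdsLT_iff_exists_Ioo_subset.1 hU'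
    have ha' : a < -tb := ha
    obtain ⟨t, ht, hPt⟩ :=
      lebL3F_exists_mem_Ioo (max_lt hT₀ (show a + tb < 0 by linarith)) hgood
    have h1 : T₀ < t := (le_max_left _ _).trans_lt ht.1
    have h2 : a + tb < t := (le_max_right _ _).trans_lt ht.1
    refine ⟨t - tb, haU ⟨by linarith, by linarith [ht.2]⟩, ?_⟩
    rw [add_sub_cancel]
    exact hPt h1 ht.2
  -- Seregin 2012, Thm 1.1: the point `(-tb, 0)` is regular for the Kato solution
  obtain ⟨r, hr, hfin⟩ :=
    seregin_regular_of_liminf_L3_holds one_pos (show (0 : ℝ) < -tb by linarith [htb.2]) h3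
      (hdiv tb htb.2) hU hlim 0
  -- translate time by `tb`: `Q_r(-tb, 0)` for `s ↦ v (tb + s)` is `Q_r(0, 0)` for `v`
  have e1 : (uncurry fun s => v (tb + s)) =
      uncurry v ∘ stAffine 1 1 tb (0 : EuclideanSpace ℝ (Fin 3)) := by
    funext ⟨s, y⟩
    simp [stAffine]
  have e2 : stAffine 1 1 tb (0 : EuclideanSpace ℝ (Fin 3)) ⁻¹'
      parabolicCylinder r ((0 : ℝ), (0 : EuclideanSpace ℝ (Fin 3))) =
        parabolicCylinder r ((-tb : ℝ), (0 : EuclideanSpace ℝ (Fin 3))) := by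
    simp only [parabolicCylinder]
    rw [stAffine_preimage_cylinder one_pos one_pos]
    congr 1
    · congr 1 <;> ring
    · simp
  rw [e1, ← e2, eLpNorm_top_comp_stAffine_restrict_preimage one_pos one_pos] at hfin
  -- `u = v` a.e. on `Q_r(0, 0) ⊆ (-∞, 0) × ℝ³`, while the origin is singular for `u`
  have e3 : eLpNorm (uncurry u) ∞ (volume.restrict
      (parabolicCylinder r ((0 : ℝ), (0 : EuclideanSpace ℝ (Fin 3))))) =
        eLpNorm (uncurry v) ∞ (volume.restrict
          (parabolicCylinder r ((0 : ℝ), (0 : EuclideanSpace ℝ (Fin 3))))) :=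
    eLpNorm_congr_ae
      (ae_restrict_of_ae_restrict_of_subset (parabolicCylinder_origin_subset_slab r) hae)
  rw [← e3] at hfin
  exact hfin.ne (hsing r hr)

end Summit.NavierStokesRegularity.NavierStokesRegularity.Theorems
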